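import Mathlib

/-!
# Positivity of a rank-one update of a symmetric operator with one negative direction
# (the "inertia half" of the rank-one positivity test)

Topic `Literature/Analysis/InnerProduct` (next to `RankOneInterlacing`). Let `T` be a symmetric
operator on a real inner product space, `φ₀` a unit eigenvector with eigenvalue `E₀ < 0`, and
suppose the form of `T` is nonnegative on the hyperplane `φ₀ᗮ`. Write `p = ⟪v, φ₀⟫`,
`v' = v − p φ₀ ∈ φ₀ᗮ`, and let `w ∈ φ₀ᗮ` solve `T w = v'` (so `c := ⟪T w, w⟫ = ⟪v', T⁻¹ v'⟫ ≥ 0`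
and `⟪v, T⁻¹ v⟫ = p²/E₀ + c`). Then

  `T + |v⟩⟨v| ≥ 0   ⟺   1 + ⟪v, T⁻¹ v⟫ ≤ 0   ⟺   (1 + c)·(−E₀) ≤ p²`.

This is the Schur-complement / bordered-matrix criterion for a rank-one perturbation with a single
negative inertia index, proved here WITHOUT determinants: decompose `x = α φ₀ + y`, `y ⊥ φ₀`, use
Cauchy–Schwarz in the `T`-semi-inner-product on `φ₀ᗮ` (`sq_inner_le_of_nonneg_form`), and minimise
a quadratic in `⟪v', y⟫`. Closest printed forms: Horn–Johnson, *Matrix Analysis*, 2nd ed.,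
identity (7.7.5) and Thm 7.7.7 (Schur-complement positivity criterion — stated there for a block
`A` that is positive DEFINITE, whereas here `T` is indefinite with one negative direction, which is
why the criterion is proved directly in this inertia form) and the bordered determinant /
Sherman–Morrison formula (0.8.5.11). [HornJohnson2013, (7.7.5), Thm 7.7.7, (0.8.5.11)]

* `sq_inner_le_of_nonneg_form` — Cauchy–Schwarz for the nonnegative form `⟪T y, z⟫` on a subspace;
* `rankOne_psd_of_inertia` — sufficiency: `(1 + c)(−E₀) ≤ p²` ⇒ `⟪T x, x⟫ + ⟪v, x⟫² ≥ 0` for all `x`;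
* `inertia_of_rankOne_psd` — necessity: `⟪T x, x⟫ + ⟪v, x⟫² ≥ 0` for all `x` ⇒ `(1 + c)(−E₀) ≤ p²`;
* `rankOne_psd_iff_inertia` — the equivalence.

No definitions, no named facts; no finite-dimensionality is assumed (the solvability `T w = v'` on
`φ₀ᗮ` is a hypothesis, automatic in finite dimension when `T` is positive definite on `φ₀ᗮ`).
-/

noncomputable section

open scoped InnerProductSpace RealInnerProductSpace

namespace Literature.Analysis.InnerProduct

variable {E : Type*} [NormedAddCommGroup E] [InnerProductSpace ℝ E]

/-- **Cauchy–Schwarz for a nonnegative symmetric form** `(y, z) ↦ ⟪T y, z⟫` on a subspace `P`. [folklore] -/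
theorem sq_inner_le_of_nonneg_form (T : E →ₗ[ℝ] E) (hsym : ∀ x y : E, ⟪T x, y⟫_ℝ = ⟪x, T y⟫_ℝ)
    (P : Submodule ℝ E) (hP : ∀ y ∈ P, 0 ≤ ⟪T y, y⟫_ℝ) {y z : E} (hy : y ∈ P) (hz : z ∈ P) :
    ⟪T y, z⟫_ℝ ^ 2 ≤ ⟪T y, y⟫_ℝ * ⟪T z, z⟫_ℝ := by
  have hzy : ⟪T z, y⟫_ℝ = ⟪T y, z⟫_ℝ := by rw [hsym, real_inner_comm]
  have hq : ∀ t : ℝ, 0 ≤ ⟪T z, z⟫_ℝ * (t * t) + (2 * ⟪T y, z⟫_ℝ) * t + ⟪T y, y⟫_ℝ := by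
    intro t
    have hmem : y + t • z ∈ P := P.add_mem hy (P.smul_mem t hz)
    have h := hP _ hmem
    rw [map_add, map_smul, inner_add_left, inner_add_right, inner_add_right, inner_smul_left,
      inner_smul_right, inner_smul_right, inner_smul_left, hzy] at h
    simp only [RCLike.conj_to_real] at h
    nlinarith [h]
  have hd := discrim_le_zero hq
  rw [discrim] at hd
  nlinarith [hd]

/-- **Sufficiency**: with `c = ⟪T w, w⟫` (`w ⊥ φ₀`, `T w = v − ⟪v, φ₀⟫ φ₀`), the condition
`(1 + c)·(−E₀) ≤ ⟪v, φ₀⟫²` (i.e. `1 + ⟪v, T⁻¹ v⟫ ≤ 0`) makes `T + |v⟩⟨v|` form-nonnegative. [cite: HornJohnson2013, Thm 7.7.7 / (7.7.5), inertia form] -/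
theorem rankOne_psd_of_inertia (T : E →ₗ[ℝ] E) (hsym : ∀ x y : E, ⟪T x, y⟫_ℝ = ⟪x, T y⟫_ℝ)
    (φ₀ : E) (hφ : ‖φ₀‖ = 1) (E₀ : ℝ) (hTφ : T φ₀ = E₀ • φ₀)
    (hpos : ∀ y : E, ⟪φ₀, y⟫_ℝ = 0 → 0 ≤ ⟪T y, y⟫_ℝ)
    (v w : E) (hw : ⟪φ₀, w⟫_ℝ = 0) (hTw : T w = v - ⟪v, φ₀⟫_ℝ • φ₀)
    (hcond : (1 + ⟪T w, w⟫_ℝ) * (-E₀) ≤ ⟪v, φ₀⟫_ℝ ^ 2) :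
    ∀ x : E, 0 ≤ ⟪T x, x⟫_ℝ + ⟪v, x⟫_ℝ ^ 2 := by
  intro x
  set p := ⟪v, φ₀⟫_ℝ with hp
  set α := ⟪φ₀, x⟫_ℝ with hα
  set y := x - α • φ₀ with hydef
  have hφφ : ⟪φ₀, φ₀⟫_ℝ = 1 := by rw [real_inner_self_eq_norm_sq, hφ]; norm_num
  have hy : ⟪φ₀, y⟫_ℝ = 0 := by
    rw [hydef, inner_sub_right, inner_smul_right, hφφ]; ring
  have hx : x = α • φ₀ + y := by rw [hydef]; abel
  -- the form of `T` splits
  have hTyφ : ⟪T y, φ₀⟫_ℝ = 0 := by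
    rw [hsym, hTφ, inner_smul_right, real_inner_comm, hy]; ring
  have hTx : ⟪T x, x⟫_ℝ = E₀ * α ^ 2 + ⟪T y, y⟫_ℝ := by
    rw [hx, map_add, map_smul, hTφ]
    simp only [inner_add_left, inner_add_right, inner_smul_left, inner_smul_right,
      RCLike.conj_to_real, hφφ, hy, hTyφ]
    ring
  -- the linear functional splits
  set s := ⟪T w, y⟫_ℝ with hs
  have hTwφ : ⟪T w, φ₀⟫_ℝ = 0 := by
    rw [hsym, hTφ, inner_smul_right, real_inner_comm, hw]; ring
  have hvx : ⟪v, x⟫_ℝ = p * α + s := by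
    have hv : v = T w + p • φ₀ := by rw [hTw]; abel
    rw [hx, hv]
    simp only [inner_add_left, inner_add_right, inner_smul_left, inner_smul_right,
      RCLike.conj_to_real, hTwφ, hφφ, hy]
    ring
  -- Cauchy–Schwarz in the `T`-form on `φ₀ᗮ`
  set c := ⟪T w, w⟫_ℝ with hc
  set q := ⟪T y, y⟫_ℝ with hq
  have hc0 : 0 ≤ c := hpos w hw
  have hq0 : 0 ≤ q := hpos y hy
  have hcs : s ^ 2 ≤ c * q := by
    have hP : ∀ z ∈ (ℝ ∙ φ₀)ᗮ, 0 ≤ ⟪T z, z⟫_ℝ := fun z hz =>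
      hpos z ((Submodule.mem_orthogonal_singleton_iff_inner_right).1 hz)
    exact sq_inner_le_of_nonneg_form T hsym _ hP
      ((Submodule.mem_orthogonal_singleton_iff_inner_right).2 hw)
      ((Submodule.mem_orthogonal_singleton_iff_inner_right).2 hy)
  rw [hTx, hvx]
  rcases hc0.eq_or_lt with hc0' | hcpos
  · -- `c = 0` forces `s = 0`
    have hs0 : s = 0 := by
      have : s ^ 2 ≤ 0 := by rw [← hc0'] at hcs; simpa using hcs
      nlinarith [sq_nonneg s]
    rw [← hc0'] at hcond
    rw [hs0]
    nlinarith [mul_nonneg (sq_nonneg α) (by linarith : (0:ℝ) ≤ p ^ 2 + E₀)]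
  · have hA : 0 ≤ c * ((1 + c) * q + (1 + c) * (p * α + s) ^ 2 - p ^ 2 * α ^ 2) := by
      nlinarith [sq_nonneg ((1 + c) * s + c * p * α), mul_le_mul_of_nonneg_left hcs
        (by linarith : (0:ℝ) ≤ 1 + c)]
    have hA' : 0 ≤ (1 + c) * q + (1 + c) * (p * α + s) ^ 2 - p ^ 2 * α ^ 2 :=
      nonneg_of_mul_nonneg_right (by linarith [hA]) hcpos
    have hcond' : (1 + c) * (-E₀) * α ^ 2 ≤ p ^ 2 * α ^ 2 :=
      mul_le_mul_of_nonneg_right hcond (sq_nonneg α)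
    have : 0 ≤ (1 + c) * (E₀ * α ^ 2 + q + (p * α + s) ^ 2) := by nlinarith [hA', hcond']
    exact nonneg_of_mul_nonneg_right (by linarith [this]) (by linarith : (0:ℝ) < 1 + c)


/-- **Necessity**: if `T + |v⟩⟨v|` is form-nonnegative then `(1 + c)·(−E₀) ≤ ⟪v, φ₀⟫²`
(test vector `x = φ₀ − (p/(1 + c)) w`). [cite: HornJohnson2013, Thm 7.7.7 / (7.7.5), inertia form] -/
theorem inertia_of_rankOne_psd (T : E →ₗ[ℝ] E) (hsym : ∀ x y : E, ⟪T x, y⟫_ℝ = ⟪x, T y⟫_ℝ)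
    (φ₀ : E) (hφ : ‖φ₀‖ = 1) (E₀ : ℝ) (hTφ : T φ₀ = E₀ • φ₀)
    (hpos : ∀ y : E, ⟪φ₀, y⟫_ℝ = 0 → 0 ≤ ⟪T y, y⟫_ℝ)
    (v w : E) (hw : ⟪φ₀, w⟫_ℝ = 0) (hTw : T w = v - ⟪v, φ₀⟫_ℝ • φ₀)
    (hpsd : ∀ x : E, 0 ≤ ⟪T x, x⟫_ℝ + ⟪v, x⟫_ℝ ^ 2) :
    (1 + ⟪T w, w⟫_ℝ) * (-E₀) ≤ ⟪v, φ₀⟫_ℝ ^ 2 := by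
  set p := ⟪v, φ₀⟫_ℝ with hp
  set c := ⟪T w, w⟫_ℝ with hc
  have hc0 : 0 ≤ c := hpos w hw
  have hc1 : 0 < 1 + c := by linarith
  set t : ℝ := -p / (1 + c) with ht
  have htc : t * (1 + c) = -p := by rw [ht]; field_simp
  have hφφ : ⟪φ₀, φ₀⟫_ℝ = 1 := by rw [real_inner_self_eq_norm_sq, hφ]; norm_num
  have hTwφ : ⟪T w, φ₀⟫_ℝ = 0 := by
    rw [hsym, hTφ, inner_smul_right, real_inner_comm, hw]; ring
  have hv : v = T w + p • φ₀ := by rw [hTw]; abel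
  have h := hpsd (φ₀ + t • w)
  have hTx : ⟪T (φ₀ + t • w), φ₀ + t • w⟫_ℝ = E₀ + t ^ 2 * c := by
    rw [map_add, map_smul, hTφ]
    simp only [inner_add_left, inner_add_right, inner_smul_left, inner_smul_right,
      RCLike.conj_to_real, hφφ, hw, hTwφ]
    ring
  have hvx : ⟪v, φ₀ + t • w⟫_ℝ = p + t * c := by
    rw [hv]
    simp only [inner_add_left, inner_add_right, inner_smul_left, inner_smul_right,
      RCLike.conj_to_real, hφφ, hw, hTwφ]
    ring
  rw [hTx, hvx] at h
  have key : (1 + c) * (E₀ + t ^ 2 * c + (p + t * c) ^ 2) = (1 + c) * E₀ + p ^ 2 := by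
    linear_combination c * ((1 + c) * t + p) * htc
  nlinarith [mul_nonneg hc1.le h, key]

/-- **The rank-one positivity test** for a symmetric `T` with one negative direction `φ₀`
(`T φ₀ = E₀ φ₀`) and nonnegative form on `φ₀ᗮ`: with `w ⊥ φ₀`, `T w = v − ⟪v, φ₀⟫ φ₀`,
`c = ⟪T w, w⟫` (so that `1 + ⟪v, T⁻¹ v⟫ = 1 + c + ⟪v, φ₀⟫²/E₀`),

  `(∀ x, 0 ≤ ⟪T x, x⟫ + ⟪v, x⟫²)  ↔  (1 + c)·(−E₀) ≤ ⟪v, φ₀⟫²`.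
[cite: HornJohnson2013, Thm 7.7.7 / (7.7.5), inertia form] -/
theorem rankOne_psd_iff_inertia (T : E →ₗ[ℝ] E) (hsym : ∀ x y : E, ⟪T x, y⟫_ℝ = ⟪x, T y⟫_ℝ)
    (φ₀ : E) (hφ : ‖φ₀‖ = 1) (E₀ : ℝ) (hTφ : T φ₀ = E₀ • φ₀)
    (hpos : ∀ y : E, ⟪φ₀, y⟫_ℝ = 0 → 0 ≤ ⟪T y, y⟫_ℝ)
    (v w : E) (hw : ⟪φ₀, w⟫_ℝ = 0) (hTw : T w = v - ⟪v, φ₀⟫_ℝ • φ₀) :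
    (∀ x : E, 0 ≤ ⟪T x, x⟫_ℝ + ⟪v, x⟫_ℝ ^ 2) ↔ (1 + ⟪T w, w⟫_ℝ) * (-E₀) ≤ ⟪v, φ₀⟫_ℝ ^ 2 :=
  ⟨inertia_of_rankOne_psd T hsym φ₀ hφ E₀ hTφ hpos v w hw hTw,
    rankOne_psd_of_inertia T hsym φ₀ hφ E₀ hTφ hpos v w hw hTw⟩

end Literature.Analysis.InnerProduct

end
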